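import Summits.ResolutionOfSingularities.ResolutionOfSingularities.Theorems.FrobeniusLadderFInjectiveMacaulayficationWeightedConeCore
import Summits.ResolutionOfSingularities.ResolutionOfSingularities.Theorems.FrobeniusLadderFInjectiveMacaulayficationClauseOfMaximal
import Mathlib.RingTheory.Jacobson.Ring
import HarnessLib

/-!
# G5ᶜⁱ-rel core: the relative monomial blow-up engine on `Spec k[X]/F` for an ARBITRARY prime ideal `F`
# (crux `FInjectiveMacaulayfication`, CI-CN engine glue; seat res-L1-w45a-stub-1)

[OURS · L1 W4.5a] Support file for crux stmt-ResolutionOfSingularities-15315. AI-written, weaker than expert review; no statement of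
[claim: Hironaka2017] is used. This is res-L1-w45a-stub-5's landed relative CN core `CNConeFiModelRel.cnConeFiModelRel_of_chartClause`
(p497132; itself the `J`-relative form of plan-1/stub-3's `CNConeFiModel.cnConeFiModel_of_chartClause` p495573) with the hypersurface ideal
`Ideal.span {f}` replaced by an arbitrary prime ideal `F` of `k[X]` — the scheme-level glue the CI-CN engine feeds (complete intersections
`F = (F₁, …, F_c)`; charts presented by `CIChartPresentation*`; chart clause by res-L1-w45a-stub-6's `CIChartClause` / `CIJacobian` /
`CISmoothChart`). The centre is a monomial ideal supported on the coordinate stratum `V(X_J)` (closed-centre shape: on key re-embedded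
specimens the point-centred `J = univ` form is uninhabited — res-L1-w45a-idea-1 06:11:14Z, tri-1 F27).
* `exists_maximal_not_mem_X_of_le` — Jacobson relative to `J` in `k[X]/F`;
* `mk_monomial_ne_zero` — `x̄^b ≠ 0` in the domain `k[X]/F`;
* `ciConeFiModelRel_of_chartClause` — the core (proof verbatim up to `(f) ↦ F`).
No definitions, no named facts. [folklore]
-/

set_option linter.dupNamespace false

noncomputable section

open AlgebraicGeometry CategoryTheory Literature.AlgebraicGeometry.Resolution MvPolynomial

namespace Summit.ResolutionOfSingularities.ResolutionOfSingularities.Theorems.FInjectiveMacaulayfication.CIConeFiModelCore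

open Summit.ResolutionOfSingularities.ResolutionOfSingularities.Theorems.FInjectiveMacaulayfication

/-- `x̄^b ≠ 0` in the domain `k[X]/F` when every `x̄ⱼ ≠ 0`. [folklore] -/
theorem mk_monomial_ne_zero {k : Type} [Field k] {n : ℕ} (F : Ideal (MvPolynomial (Fin n) k))
    [F.IsPrime]
    (hXne : ∀ v : Fin n, Ideal.Quotient.mk F (MvPolynomial.X v) ≠ 0) (b : Fin n →₀ ℕ) :
    Ideal.Quotient.mk F (monomial b (1 : k)) ≠ 0 := by
  haveI : IsDomain (MvPolynomial (Fin n) k ⧸ F) := Ideal.Quotient.isDomain _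
  rw [monomial_eq, C_1, one_mul, Finsupp.prod, map_prod]
  refine Finset.prod_ne_zero_iff.mpr fun j _ => ?_
  rw [map_pow]
  exact pow_ne_zero _ (hXne j)

/-- In the Jacobson ring `k[X]/F`: if `I ⊆ (x̄ⱼ : j ∈ J)` and a prime `P` does not contain `I`, some maximal `Q ⊇ P` misses
some `x̄ⱼ` with `j ∈ J` (`CNConeFiModelRel.exists_maximal_not_mem_X_of_le` with `(f) ↦ F`). [folklore] -/
theorem exists_maximal_not_mem_X_of_le {k : Type} [Field k] {n : ℕ} (F : Ideal (MvPolynomial (Fin n) k)) (J : Finset (Fin n))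
    (I : Ideal (MvPolynomial (Fin n) k ⧸ F))
    (hI : I ≤ Ideal.span ((fun j : Fin n => Ideal.Quotient.mk F (X j)) '' (J : Set (Fin n))))
    (P : Ideal (MvPolynomial (Fin n) k ⧸ F)) [P.IsPrime] (hP : ¬ I ≤ P) :
    ∃ (Q : Ideal (MvPolynomial (Fin n) k ⧸ F)), Q.IsMaximal ∧ P ≤ Q ∧
      ∃ j ∈ J, Ideal.Quotient.mk F (X j) ∉ Q := by
  by_contra hcon
  push Not at hcon
  apply hP
  have hJ : P.jacobson = P := IsJacobsonRing.out inferInstance (Ideal.IsPrime.isRadical ‹_›)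
  refine hI.trans ?_
  rw [← hJ, Ideal.jacobson, Ideal.span_le]
  rintro _ ⟨j, hj, rfl⟩
  simp only [SetLike.mem_coe, Ideal.mem_sInf, Set.mem_setOf_eq]
  rintro Q ⟨hPQ, hQ⟩
  exact hcon Q hQ hPQ j hj

/-- **G5ᶜⁱ-rel core — THE RELATIVE MONOMIAL BLOW-UP ENGINE ON `Spec k[X]/F`, CORE FORM** (res-L1-w45a-stub-5's
`CNConeFiModelRel.cnConeFiModelRel_of_chartClause` p497132 VERBATIM with the hypersurface `(f)` replaced by an ARBITRARY prime `F`):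
`J ⊆ Fin n`, `A` a finite set of exponents each involving a `J`-variable (so the centre `I_A·R` is supported on `V(X_J) ∩ X`), vertex
exponents `m_c ∈ A` whose charts cover (cover identities), `F` prime with all `x̄ⱼ ≠ 0`; if `R = k[X]/F` satisfies the clause at the
maximal ideals OFF `V(X_J)` and every affine blow-up algebra `R[I_A R/x̄^(m_c)]` (the strict-transform charts, `CIChartPresentationRange`)
satisfies the Cohen–Macaulay + Frobenius-closed clause at its maximal ideals containing `x̄^(m_c)`, then `Spec R` admits the crux's model
(E6‴ `BlowupFiModelOfCover` + `ReesCoverOfPowers`; off the centre by Jacobson relative to `J`). `J = univ` is the point-centred case —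
which has NO instance on key re-embedded complete intersections (res-L1-w45a-idea-1 06:11:14Z retraction, tri-1 F27), whence the
relative form is the one the CI-CN engine uses (closed centre `V(X_J) ∩ X`, strat-1 (β₄)). [folklore] -/
theorem ciConeFiModelRel_of_chartClause (p : ℕ) [Fact p.Prime] (k : Type) [Field k] [CharP k p] (n : ℕ) (J : Finset (Fin n))
    (A : Finset (Fin n →₀ ℕ)) (hAJ : ∀ a ∈ A, ∃ j ∈ J, 0 < a j)
    (t : ℕ) (ht : 0 < t) (m : Fin t → (Fin n →₀ ℕ)) (hm : ∀ c : Fin t, m c ∈ A)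
    (hcov : ∀ a ∈ A, ∃ (c : Fin t) (K : ℕ), 1 ≤ K ∧ ∃ y ∈ (Ideal.span ((fun b : Fin n →₀ ℕ => (MvPolynomial.monomial b (1 : k) : MvPolynomial (Fin n) k)) '' (A : Set (Fin n →₀ ℕ)))) ^ (K - 1),
      (MvPolynomial.monomial a (1 : k) : MvPolynomial (Fin n) k) ^ K = MvPolynomial.monomial (m c) 1 * y)
    (F : Ideal (MvPolynomial (Fin n) k)) (hfprime : F.IsPrime)
    (hXne : ∀ v : Fin n, Ideal.Quotient.mk F (MvPolynomial.X v) ≠ 0)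
    (hoff : ∀ (Q : Ideal (MvPolynomial (Fin n) k ⧸ F)) [Q.IsMaximal],
      (∃ j ∈ J, Ideal.Quotient.mk F (MvPolynomial.X j) ∉ Q) →
      ∀ d : ℕ, ringKrullDim (Localization.AtPrime Q) = d → ∀ s : Fin d → Localization.AtPrime Q,
        (Ideal.span (Set.range s)).radical.IsMaximal →
          RingTheory.Sequence.IsWeaklyRegular (Localization.AtPrime Q) (List.ofFn s) ∧
          ∀ y : Localization.AtPrime Q, (∃ e : ℕ, y ^ p ^ e ∈ Ideal.span
            ((fun z : Localization.AtPrime Q => z ^ p ^ e) ''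
              (Ideal.span (Set.range s) : Set (Localization.AtPrime Q)))) → y ∈ Ideal.span (Set.range s))
    (hon : ∀ (c : Fin t) (Q : Ideal (blowupAlgebra (Ideal.span ((fun b : Fin n →₀ ℕ => Ideal.Quotient.mk F (MvPolynomial.monomial b (1 : k))) '' (A : Set (Fin n →₀ ℕ)))) (Ideal.Quotient.mk F (MvPolynomial.monomial (m c) 1)))) [Q.IsMaximal],
      algebraMap (MvPolynomial (Fin n) k ⧸ F) (blowupAlgebra (Ideal.span ((fun b : Fin n →₀ ℕ => Ideal.Quotient.mk F (MvPolynomial.monomial b (1 : k))) '' (A : Set (Fin n →₀ ℕ)))) (Ideal.Quotient.mk F (MvPolynomial.monomial (m c) 1))) (Ideal.Quotient.mk F (MvPolynomial.monomial (m c) 1)) ∈ Q →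
      ∀ d : ℕ, ringKrullDim (Localization.AtPrime Q) = d → ∀ s : Fin d → Localization.AtPrime Q,
        (Ideal.span (Set.range s)).radical.IsMaximal →
          RingTheory.Sequence.IsWeaklyRegular (Localization.AtPrime Q) (List.ofFn s) ∧
          ∀ y : Localization.AtPrime Q, (∃ e : ℕ, y ^ p ^ e ∈ Ideal.span
            ((fun z : Localization.AtPrime Q => z ^ p ^ e) ''
              (Ideal.span (Set.range s) : Set (Localization.AtPrime Q)))) → y ∈ Ideal.span (Set.range s)) :
    ∃ (X' : Scheme.{0}) (π : X' ⟶ Spec (.of (MvPolynomial (Fin n) k ⧸ F))), IsProper π ∧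
      Literature.AlgebraicGeometry.Resolution.IsBirational π ∧
      ∀ y : X', IsDomain (X'.presheaf.stalk y) ∧ ∀ d : ℕ, ringKrullDim (X'.presheaf.stalk y) = d →
        ∀ s : Fin d → X'.presheaf.stalk y, (Ideal.span (Set.range s)).radical.IsMaximal →
          RingTheory.Sequence.IsWeaklyRegular (X'.presheaf.stalk y) (List.ofFn s) ∧
          ∀ z : X'.presheaf.stalk y, (∃ e : ℕ, z ^ p ^ e ∈
              Ideal.span ((fun w : X'.presheaf.stalk y => w ^ p ^ e) ''
                (Ideal.span (Set.range s) : Set (X'.presheaf.stalk y)))) →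
            z ∈ Ideal.span (Set.range s) := by
  haveI := hfprime
  haveI : IsDomain (MvPolynomial (Fin n) k ⧸ F) := Ideal.Quotient.isDomain _
  haveI : CharP (MvPolynomial (Fin n) k ⧸ F) p :=
    charP_of_injective_algebraMap (algebraMap k (MvPolynomial (Fin n) k ⧸ F)).injective p
  -- names: the centre `I = I_A · R` and the covering sub-family `v c = x̄ ^ (m c)`
  obtain ⟨I, hI⟩ : ∃ I : Ideal (MvPolynomial (Fin n) k ⧸ F), I = Ideal.span ((fun b : Fin n →₀ ℕ => Ideal.Quotient.mk F (MvPolynomial.monomial b (1 : k))) '' (A : Set (Fin n →₀ ℕ))) := ⟨_, rfl⟩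
  -- the same ideal written as an extension
  have hImap : I = (Ideal.span ((fun b : Fin n →₀ ℕ => (MvPolynomial.monomial b (1 : k) : MvPolynomial (Fin n) k)) '' (A : Set (Fin n →₀ ℕ)))).map (Ideal.Quotient.mk F) := by
    rw [hI, Ideal.map_span, Set.image_image]
  obtain ⟨v, hv⟩ : ∃ v : Fin t → MvPolynomial (Fin n) k ⧸ F,
      v = fun c => Ideal.Quotient.mk F (MvPolynomial.monomial (m c) 1) := ⟨_, rfl⟩
  have hvI : ∀ c : Fin t, v c ∈ I := by
    intro c
    rw [hv, hI]
    exact Ideal.subset_span ⟨m c, hm c, rfl⟩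
  have hv0 : ∀ c : Fin t, v c ≠ 0 := fun c => by
    rw [hv]
    exact mk_monomial_ne_zero F hXne (m c)
  have hI0 : I ≠ ⊥ := fun h => hv0 ⟨0, ht⟩ (by simpa [h] using hvI ⟨0, ht⟩)
  -- the centre lies in the ideal of the `J`-variables (every generator involves a `J`-variable)
  have hIle : I ≤ Ideal.span ((fun j : Fin n => Ideal.Quotient.mk F (MvPolynomial.X j)) '' (J : Set (Fin n))) := by
    rw [hImap, show ((fun j : Fin n => Ideal.Quotient.mk F (MvPolynomial.X j)) '' (J : Set (Fin n))) =
      Ideal.Quotient.mk F '' ((fun j : Fin n => (X j : MvPolynomial (Fin n) k)) '' (J : Set (Fin n))) from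
      by rw [Set.image_image], ← Ideal.map_span]
    refine Ideal.map_mono ?_
    rw [Ideal.span_le]
    rintro _ ⟨b, hb, rfl⟩
    obtain ⟨j, hj, hbj⟩ := hAJ b hb
    -- `x^b = X_j · x^(b - e_j)`
    have hXj : (X j : MvPolynomial (Fin n) k) ∈ Ideal.span ((fun j : Fin n => (X j : MvPolynomial (Fin n) k)) '' (J : Set (Fin n))) :=
      Ideal.subset_span ⟨j, hj, rfl⟩
    have hle : Finsupp.single j 1 ≤ b := by
      rw [Finsupp.single_le_iff]
      exact hbj
    have heq : (MvPolynomial.monomial b (1 : k) : MvPolynomial (Fin n) k) =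
        MvPolynomial.monomial (b - Finsupp.single j 1) (1 : k) * X j := by
      rw [X, monomial_mul, mul_one, tsub_add_cancel_of_le hle]
    show (MvPolynomial.monomial b (1 : k) : MvPolynomial (Fin n) k) ∈
      Ideal.span ((fun j : Fin n => (X j : MvPolynomial (Fin n) k)) '' (J : Set (Fin n)))
    rw [heq]
    exact Ideal.mul_mem_left _ _ hXj
  -- THE COVER, read off the identities `(x^a)^K = x^(m c) · y`
  have hcov' : (HomogeneousIdeal.irrelevant (reesGrading I)).toIdeal ≤
      (Ideal.span (Set.range fun c : Fin t => reesT (I := I) (v c) (hvI c))).radical := by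
    refine ReesCoverOfPowers.stub_reesCoverOfPowers _ I (Ideal.Quotient.mk F '' ((fun b : Fin n →₀ ℕ => (MvPolynomial.monomial b (1 : k) : MvPolynomial (Fin n) k)) '' (A : Set (Fin n →₀ ℕ)))) (by rw [hImap, Ideal.map_span]) t v hvI ?_
    rintro _ ⟨_, ⟨a, ha, rfl⟩, rfl⟩
    obtain ⟨c, K, hK, y, hy, hEq⟩ := hcov a ha
    refine ⟨c, K, hK, Ideal.Quotient.mk F y, ?_, ?_⟩
    · rw [hImap, ← Ideal.map_pow]
      exact Ideal.mem_map_of_mem _ hy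
    · rw [hv]
      show _ = Ideal.Quotient.mk F (MvPolynomial.monomial (m c) 1) * _
      rw [← map_pow, hEq, map_mul]
  -- OFF THE CENTRE (Jacobson, relative to `J`)
  have hoff' : ∀ (P : Ideal (MvPolynomial (Fin n) k ⧸ F)) [P.IsPrime], ¬ I ≤ P →
      IsDomain (Localization.AtPrime P) ∧
      ∀ d : ℕ, ringKrullDim (Localization.AtPrime P) = d → ∀ s : Fin d → Localization.AtPrime P,
        (Ideal.span (Set.range s)).radical.IsMaximal →
          RingTheory.Sequence.IsWeaklyRegular (Localization.AtPrime P) (List.ofFn s) ∧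
          ∀ y : Localization.AtPrime P, (∃ e : ℕ, y ^ p ^ e ∈ Ideal.span
            ((fun z : Localization.AtPrime P => z ^ p ^ e) ''
              (Ideal.span (Set.range s) : Set (Localization.AtPrime P)))) → y ∈ Ideal.span (Set.range s) := by
    intro P _ hP
    obtain ⟨Q, hQ, hPQ, j, hj, hjQ⟩ := exists_maximal_not_mem_X_of_le F J I hIle P hP
    haveI := hQ
    exact ClauseOfMaximal.fiClause_atPrime_of_le p hPQ ⟨inferInstance, hoff Q ⟨j, hj, hjQ⟩⟩
  -- ON THE EXCEPTIONAL LOCUS, chart by chart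
  have hon' : ∀ (c : Fin t) (Q : Ideal (blowupAlgebra I (v c))) [Q.IsMaximal],
      algebraMap (MvPolynomial (Fin n) k ⧸ F) (blowupAlgebra I (v c)) (v c) ∈ Q →
      ∀ d : ℕ, ringKrullDim (Localization.AtPrime Q) = d → ∀ s : Fin d → Localization.AtPrime Q,
        (Ideal.span (Set.range s)).radical.IsMaximal →
          RingTheory.Sequence.IsWeaklyRegular (Localization.AtPrime Q) (List.ofFn s) ∧
          ∀ y : Localization.AtPrime Q, (∃ e : ℕ, y ^ p ^ e ∈ Ideal.span
            ((fun z : Localization.AtPrime Q => z ^ p ^ e) ''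
              (Ideal.span (Set.range s) : Set (Localization.AtPrime Q)))) → y ∈ Ideal.span (Set.range s) := by
    subst hI hv
    intro c Q _ hQ
    exact hon c Q hQ
  exact BlowupFiModelOfCover.stub_blowupFiModelOfCover p (MvPolynomial (Fin n) k ⧸ F) I t v
    hvI hI0 hv0 hcov' hoff' hon'

end Summit.ResolutionOfSingularities.ResolutionOfSingularities.Theorems.FInjectiveMacaulayfication.CIConeFiModelCore

end
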